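import Summits.Ventures.CertifiedArithmetic.LowPrec.SRPythagorasLiabilityWindows
import HarnessLib

/-!
# CXXIV — The liability potential (V): a window-free toolkit for the two-point inequality —
# aligned cells (zero creation + cost domination across two sub-lattices) and the crude interval bound

HONEST FRAMING: certified error envelopes and provably optimal rounding/accumulation schemes for
low-precision formats under stated cost models; every table by two implementations; no hardware or
vendor claims.

Fifth file of the liability series (CXX accounting theorem `acc_sq_le_of_pairLE`, CXXI residues and
two-run windows, CXXII/CXXIII the two-point inequality `PairLE` on two-run windows).  The two-run proofs
are tied to the `TwoRunWindow` record; the next step of the programme (the two-point inequality on the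
one-signed windows of a binary FORMAT, where besides the top width `G` and the widths below `E = G/2^N`
there are intermediate `E`-aligned widths) needs the same mechanisms in a form that only talks about the
CELL DATA of the two points.  This file provides them, for any value set `F`, any field:
* `pairLE_of_bound` — the closing step: a bound `B` on the children's liability, nonnegative cost, and
  `2B ≤` (variance slack + bias slack of the two points) give `PairLE`;
* `pairStepQ_eq_zero_of_congr` — if the four candidates of `c, c'` are pairwise congruent modulo `E`
  the children owe nothing (`E`-ALIGNED cells: widths and base points in `E·ℤ`);
* `pairStepQ_le_of_interval` — if the four candidates lie in an interval of length `D`, the children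
  owe at most `D·E` (the CRUDE bound for pairs confined below a small multiple of a cell width);
* `sub_le_resid`, `resid_sub_resid_le_gen` — residue arithmetic across two nested sub-lattices
  `ρ ∣ ρ' ∣ E`: the truncations `y = (c − d) mod ρ`, `y' = (c' − d') mod ρ'` of two points whose base
  points differ by a multiple of `ρ` satisfy `y − y' ≤ (c − c') mod E` (COST DOMINATION for cells of
  different widths; CXXI's `costdom` is the case `ρ = ρ' = E`);
* `cost_nonneg_of_le` — hence the cost term `ℓ(c,c') + (c − c')(y − y')` is nonnegative for `c ≤ c'`;
* `vslackQ_ge` — a cell of width `≤ W` leaves variance slack `≥ G²/4 − W²/4`;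
* `pairLE_aligned` — THE ALIGNED CASE for StochasticA with `N` bits: two hull points `c ≤ c'` with
  `0 ≤ ⌊c̄⌋, ⌊c̄'⌋`, cells `[d, d + 2^N ρ]`, `[d', d' + 2^N ρ']` (or trivial) with `ρ ∣ ρ' ≤ E`, `ρ ∣ E`,
  widths and `d − d'` in `E·ℤ`, widths `≤ G`: `PairLE F (probAwayA N) G E c c'` (and the symmetric
  pair by `pairLE_comm`).  On a two-run window this is CXXII's `pairLE_top_top`; on a format window it
  is every pair of points in cells of width `≥ E` (all binades from the `E`-binade up), for every `N`;
* `pairLE_of_interval` — THE CRUDE CASE: candidates in an interval of length `D`, nonnegative cost,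
  truncations `≤ E`, and `2DE ≤ V(c) + V(c')` give `PairLE`; `pairLE_crudeA` packages it for
  StochasticA with the cost discharged by the sub-lattice lemma (widths `≤ W`, `2DE ≤ 2(G²/4 − W²/4)`);
* `TwoRunWindow.pairLE_top_top'` — CXXII's top/top case re-derived from `pairLE_aligned` (consistency
  check of the toolkit against the two-run development).
Exact, no `sorry`, no new definitions; nothing here is specific to a format and nothing is claimed about
formats in this file.  References: [ConnollyHighamMary2021], [ElararEtAl2025], [FitzgibbonFelix2025].
-/

namespace Summit.Ventures.CertifiedArithmetic.LowPrec.SR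

open Literature.ComputerArithmetic.ConnollyHighamMary2021
open Finset

variable {K : Type*} [Field K] [LinearOrder K] [IsStrictOrderedRing K] [FloorRing K]

namespace LimitedBits

/-! ### The closing step and the two bounds on the children's liability -/

/-- The closing step of every case: a bound on the children's liability, nonnegative cost, and enough
unused variance / bias budget. -/
theorem pairLE_of_bound (F : Finset K) (q : K → K) (G E c c' B : K)
    (hstep : pairStepQ F q E c c' ≤ B)
    (hcost : 0 ≤ pairLiab E c c' + (c - c') * (truncQ F q c - truncQ F q c'))
    (hbud : 2 * B ≤ vslackQ F q G c + E * (E - truncQ F q c)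
      + (vslackQ F q G c' + E * (E - truncQ F q c'))) :
    PairLE F q G E c c' := by
  unfold PairLE; linarith

/-- `E`-congruent candidates owe nothing: if the four candidates of `c, c'` are pairwise congruent
modulo `E`, the expected liability of the children vanishes (any rule). -/
theorem pairStepQ_eq_zero_of_congr (F : Finset K) (q : K → K) {E c c' : K} (hE : 0 < E)
    (h1 : ∃ z : ℤ, up F c - up F c' = z * E) (h2 : ∃ z : ℤ, up F c - dn F c' = z * E)
    (h3 : ∃ z : ℤ, dn F c - up F c' = z * E) (h4 : ∃ z : ℤ, dn F c - dn F c' = z * E) :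
    pairStepQ F q E c c' = 0 := by
  obtain ⟨z1, h1⟩ := h1
  obtain ⟨z2, h2⟩ := h2
  obtain ⟨z3, h3⟩ := h3
  obtain ⟨z4, h4⟩ := h4
  simp only [pairStepQ, stepQ, pairLiab_eq_zero_of_dvd hE h1, pairLiab_eq_zero_of_dvd hE h2,
    pairLiab_eq_zero_of_dvd hE h3, pairLiab_eq_zero_of_dvd hE h4]
  ring

/-- The CRUDE bound: if the four candidates of `c, c'` lie in an interval of length `D`, the children
owe at most `D·E` (any rule with probabilities in `[0,1]`). -/
theorem pairStepQ_le_of_interval (F : Finset K) {q : K → K}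
    (hq01 : ∀ θ, 0 ≤ θ → θ ≤ 1 → 0 ≤ q θ ∧ q θ ≤ 1) {E c c' A D : K} (hE : 0 < E)
    (hdc : A ≤ dn F c) (huc : up F c ≤ A + D) (hdu : dn F c ≤ up F c)
    (hdc' : A ≤ dn F c') (huc' : up F c' ≤ A + D) (hdu' : dn F c' ≤ up F c') :
    pairStepQ F q E c c' ≤ D * E := by
  have key : ∀ a b : K, A ≤ a → a ≤ A + D → A ≤ b → b ≤ A + D → pairLiab E a b ≤ D * E := by
    intro a b ha1 ha2 hb1 hb2
    have h := pairLiab_le hE a b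
    have hab : |a - b| ≤ D := abs_sub_le_iff.mpr ⟨by linarith, by linarith⟩
    exact h.trans (mul_le_mul_of_nonneg_right hab hE.le)
  obtain ⟨hp0, hp1⟩ := pUpQ_mem F hq01 c
  obtain ⟨hp0', hp1'⟩ := pUpQ_mem F hq01 c'
  have k1 := key _ _ (hdc.trans hdu) huc (hdc'.trans hdu') huc'
  have k2 := key _ _ (hdc.trans hdu) huc hdc' (hdu'.trans huc')
  have k3 := key _ _ hdc (hdu.trans huc) (hdc'.trans hdu') huc'
  have k4 := key _ _ hdc (hdu.trans huc) hdc' (hdu'.trans huc')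
  have i1 : stepQ F q c' (fun b => pairLiab E (up F c) b) ≤ D * E := by
    unfold stepQ
    have a1 := mul_le_mul_of_nonneg_left k1 hp0'
    have a2 := mul_le_mul_of_nonneg_left k2 (show 0 ≤ 1 - pUpQ F q c' by linarith)
    linarith
  have i2 : stepQ F q c' (fun b => pairLiab E (dn F c) b) ≤ D * E := by
    unfold stepQ
    have a1 := mul_le_mul_of_nonneg_left k3 hp0'
    have a2 := mul_le_mul_of_nonneg_left k4 (show 0 ≤ 1 - pUpQ F q c' by linarith)
    linarith
  unfold pairStepQ
  unfold stepQ at i1 i2 ⊢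
  have a1 := mul_le_mul_of_nonneg_left i1 hp0
  have a2 := mul_le_mul_of_nonneg_left i2 (show 0 ≤ 1 - pUpQ F q c by linarith)
  linarith

/-! ### Residues across two nested sub-lattices: cost domination for cells of different widths -/

/-- If `t = zρ + (a − b)` with `a < ρ`, `0 ≤ b` and `E = Lρ`, `L ≥ 1`, then `a − b ≤ t mod E`. -/
theorem sub_le_resid {ρ E t a b : K} (hρ : 0 < ρ) {L : ℕ} (hL : 1 ≤ L) (hE : E = L * ρ)
    (ha : a < ρ) (hb : 0 ≤ b) (z : ℤ) (ht : t = z * ρ + (a - b)) : a - b ≤ resid t E := by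
  have hEpos : 0 < E := by rw [hE]; positivity
  obtain ⟨h0, -⟩ := resid_nonneg_lt (y := t) hEpos
  by_cases hab : a - b ≤ 0
  · linarith
  · set j : ℤ := z - (L : ℤ) * ⌊t / E⌋ with hj
    have e : resid t E = (j : K) * ρ + (a - b) := by
      simp only [hj, resid]; push_cast; rw [hE] at *; linear_combination ht
    have hj0 : (0 : ℤ) ≤ j := by
      by_contra hneg
      have h1 : (j : K) + 1 ≤ 0 := by exact_mod_cast Int.lt_iff_add_one_le.mp (not_le.mp hneg)
      have h2 := mul_le_mul_of_nonneg_right h1 hρ.le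
      linarith
    have hj0' : (0 : K) ≤ (j : K) * ρ := mul_nonneg (by exact_mod_cast hj0) hρ.le
    linarith

/-- **Cost domination across two sub-lattices.**  For `ρ ∣ ρ'` (`ρ' = Mρ`), `E = Lρ` (`L ≥ 1`) and base
points with `d − d' ∈ ρ·ℤ`: `(c − d) mod ρ − (c' − d') mod ρ' ≤ (c − c') mod E`. -/
theorem resid_sub_resid_le_gen {ρ ρ' E c c' d d' : K} (hρ : 0 < ρ) (hρ' : 0 < ρ') {L M : ℕ}
    (hL : 1 ≤ L) (hE : E = L * ρ) (hM : ρ' = M * ρ) {z : ℤ} (hdd : d - d' = z * ρ) :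
    resid (c - d) ρ - resid (c' - d') ρ' ≤ resid (c - c') E := by
  refine sub_le_resid hρ hL hE (resid_nonneg_lt hρ).2 (resid_nonneg_lt hρ').1
    (z + ⌊(c - d) / ρ⌋ - (M : ℤ) * ⌊(c' - d') / ρ'⌋) ?_
  unfold resid; push_cast; rw [hM] at *; linear_combination hdd

/-- The cost term is nonnegative as soon as the truncation difference is dominated by the lead:
`c ≤ c'`, `y − y' ≤ (c − c') mod E` ⇒ `0 ≤ ℓ_E(c,c') + (c − c')(y − y')`. -/
theorem cost_nonneg_of_le {E c c' y y' : K} (hcc : c ≤ c')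
    (h : y - y' ≤ resid (c - c') E) : 0 ≤ pairLiab E c c' + (c - c') * (y - y') := by
  unfold pairLiab
  rw [show |c - c'| = c' - c by rw [abs_sub_comm]; exact abs_of_nonneg (by linarith),
    show -(c' - c) = c - c' by ring]
  have := mul_le_mul_of_nonneg_left h (show 0 ≤ c' - c by linarith)
  linarith

/-- A cell of width at most `W` leaves variance slack at least `G²/4 − W²/4`. -/
theorem vslackQ_ge (F : Finset K) {q : K → K} (hq01 : ∀ θ, 0 ≤ θ → θ ≤ 1 → 0 ≤ q θ ∧ q θ ≤ 1)
    {G W c : K} (hw0 : 0 ≤ up F c - dn F c) (hwW : up F c - dn F c ≤ W) :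
    G ^ 2 / 4 - W ^ 2 / 4 ≤ vslackQ F q G c := by
  unfold vslackQ
  obtain ⟨h0, h1⟩ := pUpQ_mem F hq01 c
  have hp : pUpQ F q c * (1 - pUpQ F q c) ≤ 1 / 4 := by
    nlinarith [sq_nonneg (pUpQ F q c - 1 / 2)]
  have hw2 : (up F c - dn F c) ^ 2 ≤ W ^ 2 := pow_le_pow_left₀ hw0 hwW 2
  have hpn : 0 ≤ pUpQ F q c * (1 - pUpQ F q c) := mul_nonneg h0 (by linarith)
  nlinarith

/-! ### The aligned case and the crude case of the two-point inequality (StochasticA, `N` bits) -/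

/-- **The aligned case.**  Two hull points `c ≤ c'` with nonnegative lower candidates, cells of widths
`2^N ρ` and `2^N ρ'` (or trivial) with `ρ' = Mρ ≤ E`, `E = Lρ`, widths and the base-point difference in
`E·ℤ`, widths at most `G`: the two-point inequality holds — the children owe nothing and the cost of the
truncations is dominated by the liability already owed. -/
theorem pairLE_aligned (F : Finset K) (N : ℕ) {G E ρ ρ' c c' : K} {L M : ℕ}
    (hc : InHull F c) (hc' : InHull F c') (hd0 : 0 ≤ dn F c) (hd0' : 0 ≤ dn F c')
    (hρ : 0 < ρ) (hρ' : 0 < ρ') (hL : 1 ≤ L) (hEL : E = L * ρ) (hM : ρ' = M * ρ) (hρ'E : ρ' ≤ E)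
    (hw : up F c = dn F c ∨ up F c = dn F c + 2 ^ N * ρ)
    (hw' : up F c' = dn F c' ∨ up F c' = dn F c' + 2 ^ N * ρ')
    (hwE : ∃ a : ℤ, up F c - dn F c = a * E) (hwE' : ∃ a : ℤ, up F c' - dn F c' = a * E)
    (hdd : ∃ z : ℤ, dn F c - dn F c' = z * E)
    (hwG : up F c - dn F c ≤ G) (hwG' : up F c' - dn F c' ≤ G) (hcc : c ≤ c') :
    PairLE F (probAwayA N) G E c c' := by
  have hq01 : ∀ θ : K, 0 ≤ θ → θ ≤ 1 → 0 ≤ probAwayA N θ ∧ probAwayA N θ ≤ 1 :=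
    fun θ h0 h1 => probAwayA_mem N θ h0 h1
  have hE : 0 < E := by rw [hEL]; positivity
  obtain ⟨a, ha⟩ := hwE
  obtain ⟨a', ha'⟩ := hwE'
  obtain ⟨z, hz⟩ := hdd
  -- (1) the children owe nothing
  have h0 : pairStepQ F (probAwayA N) E c c' = 0 := by
    refine pairStepQ_eq_zero_of_congr F (probAwayA N) hE ⟨a + z - a', ?_⟩ ⟨a + z, ?_⟩ ⟨z - a', ?_⟩
      ⟨z, hz⟩
    · push_cast; linear_combination ha + hz - ha'
    · push_cast; linear_combination ha + hz
    · push_cast; linear_combination hz - ha'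
  -- (2) the truncations
  have hy : truncQ F (probAwayA N) c = resid (c - dn F c) ρ := by
    unfold truncQ; rw [stepQA_cell F N hc hd0 hρ hw]; ring
  have hy' : truncQ F (probAwayA N) c' = resid (c' - dn F c') ρ' := by
    unfold truncQ; rw [stepQA_cell F N hc' hd0' hρ' hw']; ring
  -- (3) cost domination across the two sub-lattices (`d − d' = zE = (zL)ρ`)
  have hcost : 0 ≤ pairLiab E c c'
      + (c - c') * (truncQ F (probAwayA N) c - truncQ F (probAwayA N) c') := by
    rw [hy, hy']
    refine cost_nonneg_of_le hcc (resid_sub_resid_le_gen hρ hρ' hL hEL hM (z := z * L) ?_)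
    rw [hz, hEL]; push_cast; ring
  -- (4) budgets
  have hM1 : ρ ≤ ρ' := by
    have hM0 : (1 : K) ≤ M := by
      have : (0 : K) < M := by
        by_contra h
        have : (M : K) ≤ 0 := not_lt.mp h
        nlinarith
      exact_mod_cast Nat.one_le_iff_ne_zero.mpr (by rintro rfl; simp at this)
    rw [hM]; nlinarith
  have hdcu : dn F c ≤ up F c := dn_le_up F c
  have hdcu' : dn F c' ≤ up F c' := dn_le_up F c'
  have hV := vslackQ_nonneg F hq01 (sub_nonneg.mpr hdcu) hwG
  have hV' := vslackQ_nonneg F hq01 (sub_nonneg.mpr hdcu') hwG'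
  have hyE : truncQ F (probAwayA N) c ≤ E := by
    rw [hy]; exact ((resid_nonneg_lt hρ).2.le.trans hM1).trans hρ'E
  have hyE' : truncQ F (probAwayA N) c' ≤ E := by
    rw [hy']; exact (resid_nonneg_lt hρ').2.le.trans hρ'E
  refine pairLE_of_bound F (probAwayA N) G E c c' 0 h0.le hcost ?_
  nlinarith [hE.le]

/-- **The crude case.**  Candidates confined to an interval of length `D`, nonnegative cost, truncations
at most `E`, and `2DE` covered by the two variance slacks: the two-point inequality holds (any rule). -/
theorem pairLE_of_interval (F : Finset K) {q : K → K}
    (hq01 : ∀ θ, 0 ≤ θ → θ ≤ 1 → 0 ≤ q θ ∧ q θ ≤ 1) {G E c c' A D : K} (hE : 0 < E)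
    (hdc : A ≤ dn F c) (huc : up F c ≤ A + D) (hdc' : A ≤ dn F c') (huc' : up F c' ≤ A + D)
    (hcost : 0 ≤ pairLiab E c c' + (c - c') * (truncQ F q c - truncQ F q c'))
    (hy : truncQ F q c ≤ E) (hy' : truncQ F q c' ≤ E)
    (hbud : 2 * (D * E) ≤ vslackQ F q G c + vslackQ F q G c') : PairLE F q G E c c' := by
  have hstep := pairStepQ_le_of_interval F hq01 hE hdc huc (dn_le_up F c) hdc' huc' (dn_le_up F c')
  refine pairLE_of_bound F q G E c c' (D * E) hstep hcost ?_
  nlinarith [hE.le]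

/-- **The crude case for StochasticA, packaged.**  Two hull points `c ≤ c'` with nonnegative lower
candidates and cells `[d, d + 2^N ρ]`, `[d', d' + 2^N ρ']` (or trivial), `ρ ∣ ρ'`, `E = Lρ`, `ρ' ≤ E`
or not — only `d − d' ∈ ρ·ℤ` is needed for the cost —, truncations at most `E`, all four candidates in
an interval `[A, A + D]`, both widths at most `W`, and the budget inequality `2DE ≤ 2(G²/4 − W²/4)`:
the two-point inequality holds.  (On a format window this is the case of a phase-keeping point against
a point of an intermediate `E`-aligned cell, `D = 2·2^m·w'`, and the case of two points below `2^m·E`.) -/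
theorem pairLE_crudeA (F : Finset K) (N : ℕ) {G E ρ ρ' c c' A D W : K} {L M : ℕ}
    (hc : InHull F c) (hc' : InHull F c') (hd0 : 0 ≤ dn F c) (hd0' : 0 ≤ dn F c')
    (hρ : 0 < ρ) (hρ' : 0 < ρ') (hL : 1 ≤ L) (hEL : E = L * ρ) (hM : ρ' = M * ρ)
    (hw : up F c = dn F c ∨ up F c = dn F c + 2 ^ N * ρ)
    (hw' : up F c' = dn F c' ∨ up F c' = dn F c' + 2 ^ N * ρ')
    (hdd : ∃ z : ℤ, dn F c - dn F c' = z * ρ)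
    (hyE : truncQ F (probAwayA N) c ≤ E) (hyE' : truncQ F (probAwayA N) c' ≤ E)
    (hdc : A ≤ dn F c) (huc : up F c ≤ A + D) (hdc' : A ≤ dn F c') (huc' : up F c' ≤ A + D)
    (hwW : up F c - dn F c ≤ W) (hwW' : up F c' - dn F c' ≤ W)
    (hbud : 2 * (D * E) ≤ 2 * (G ^ 2 / 4 - W ^ 2 / 4)) (hcc : c ≤ c') :
    PairLE F (probAwayA N) G E c c' := by
  have hq01 : ∀ θ : K, 0 ≤ θ → θ ≤ 1 → 0 ≤ probAwayA N θ ∧ probAwayA N θ ≤ 1 :=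
    fun θ h0 h1 => probAwayA_mem N θ h0 h1
  have hE : 0 < E := by rw [hEL]; positivity
  obtain ⟨z, hz⟩ := hdd
  have hy : truncQ F (probAwayA N) c = resid (c - dn F c) ρ := by
    unfold truncQ; rw [stepQA_cell F N hc hd0 hρ hw]; ring
  have hy' : truncQ F (probAwayA N) c' = resid (c' - dn F c') ρ' := by
    unfold truncQ; rw [stepQA_cell F N hc' hd0' hρ' hw']; ring
  have hcost : 0 ≤ pairLiab E c c'
      + (c - c') * (truncQ F (probAwayA N) c - truncQ F (probAwayA N) c') := by
    rw [hy, hy']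
    exact cost_nonneg_of_le hcc (resid_sub_resid_le_gen hρ hρ' hL hEL hM hz)
  have hV := vslackQ_ge F hq01 (G := G) (sub_nonneg.mpr (dn_le_up F c)) hwW
  have hV' := vslackQ_ge F hq01 (G := G) (sub_nonneg.mpr (dn_le_up F c')) hwW'
  exact pairLE_of_interval F hq01 hE hdc huc hdc' huc' hcost hyE hyE' (by linarith)

/-- The aligned case specialises to CXXII's top/top case: on a two-run window both points of the top
run have cells `[d, d + G]` on the top lattice (`ρ = ρ' = E`, `L = M = 1`). -/
theorem TwoRunWindow.pairLE_top_top' {F : Finset K} {lo mid hi g : K} {i J : ℕ}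
    (hW : TwoRunWindow F lo mid hi g i J) (hlo : 0 ≤ lo) (N : ℕ) {c c' : K}
    (hc1 : mid ≤ c) (hcc : c ≤ c') (hc2' : c' ≤ hi) :
    PairLE F (probAwayA N) (2 ^ J * g) (2 ^ J * g / 2 ^ N) c c' := by
  have hg := hW.nested.pos
  have hc2 : c ≤ hi := hcc.trans hc2'
  have hc1' : mid ≤ c' := hc1.trans hcc
  have hl : lo ≤ c := hW.lo_le_mid.trans hc1
  have hl' : lo ≤ c' := hW.lo_le_mid.trans hc1'
  obtain ⟨⟨z, hz⟩, hwc, -, hmd, hdc, hcu, huh⟩ := hW.topData hlo N hc1 hc2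
  obtain ⟨⟨z', hz'⟩, hwc', -, hmd', hdc', hcu', huh'⟩ := hW.topData hlo N hc1' hc2'
  have hGE : (2 : K) ^ J * g = 2 ^ N * (2 ^ J * g / 2 ^ N) := by field_simp
  have hlod : lo ≤ dn F c := hW.lo_le_mid.trans hmd
  have hlod' : lo ≤ dn F c' := hW.lo_le_mid.trans hmd'
  have hwid : ∀ {d u : K}, (u = d ∨ u = d + 2 ^ J * g) →
      (∃ a : ℤ, u - d = a * (2 ^ J * g / 2 ^ N)) ∧ u - d ≤ 2 ^ J * g := by
    intro d u h
    rcases h with h | h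
    · refine ⟨⟨0, ?_⟩, ?_⟩
      · rw [h]; simp
      · rw [h, sub_self]; positivity
    · refine ⟨⟨2 ^ N, ?_⟩, ?_⟩
      · rw [h]; push_cast; linear_combination hGE
      · rw [h]; exact le_of_eq (by ring)
  obtain ⟨hwE, hwG⟩ := hwid hwc
  obtain ⟨hwE', hwG'⟩ := hwid hwc'
  have hE : (0 : K) < 2 ^ J * g / 2 ^ N := by positivity
  have hdd : ∃ w : ℤ, dn F c - dn F c' = w * (2 ^ J * g / 2 ^ N) := by
    refine ⟨(z - z') * 2 ^ N, ?_⟩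
    push_cast
    have e : dn F c - dn F c' = (z - z') * (2 ^ J * g) := by linear_combination hz - hz'
    rw [e]; field_simp
  exact pairLE_aligned F N (ρ := 2 ^ J * g / 2 ^ N) (ρ' := 2 ^ J * g / 2 ^ N) (L := 1) (M := 1)
    (hW.nested.inHull hl hc2) (hW.nested.inHull hl' hc2') (hlo.trans hlod) (hlo.trans hlod') hE hE
    le_rfl (by simp) (by simp) le_rfl (by rwa [← hGE]) (by rwa [← hGE]) hwE hwE' hdd hwG hwG' hcc

end LimitedBits

end Summit.Ventures.CertifiedArithmetic.LowPrec.SR
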